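import Summits.CriticalPhenomena.PercolationContinuityZ3.Theorems.PercNearOneGluingNoHeavyLowerTailSahiCTCSmallWorldNA
import HarnessLib

/-!
# `NoHeavyLowerTail` (crux stmt-CriticalPhenomena-4575), P3 lane: CROSS negative association of two CONSECUTIVE small worlds —
# `X_{<τ}·Z_{≤τ} + X_{≤τ}·Z_{<τ} − Θ_{<τ}·Y_{≤τ} − Θ_{≤τ}·Y_{<τ} ∈ ℕ[s]` for up-sets with independent supports, every `τ`

Support file (seat `prim-l12-p3`, gen 41; `--supports stmt-CriticalPhenomena-4575`).  Memo
`run/shared/lean/prim/prim-l12/FROM-prim-l12-p3-g41-RUSSO-MONOTONE.md` §4.4.  For up-sets `𝒳, 𝒵 ⊆ 2^α` with membership in `𝒳` depending only on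
the coordinates in `I` and in `𝒵` only on those outside `I`, every coefficient of
`GF(𝒳_{<τ})·GF(𝒵_{<τ+1}) + GF(𝒳_{<τ+1})·GF(𝒵_{<τ}) − GF(sets of size <τ)·GF((𝒳∩𝒵)_{<τ+1}) − GF(sets of size <τ+1)·GF((𝒳∩𝒵)_{<τ})`
is `≥ 0` (`coeff_crossSmallWorld_nonneg_of_determined`).  At a positive point this is the "cross-NA" of the two consecutive small worlds
`ν_τ = μ(·|N<τ)`, `ν_{τ+1} = μ(·|N≤τ)` of a product measure: `ν_τ(𝒳)ν_{τ+1}(𝒵) + ν_{τ+1}(𝒳)ν_τ(𝒵) ≥ ν_τ(𝒳∩𝒵) + ν_{τ+1}(𝒳∩𝒵)`, which is the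
disjoint-support ("idle") corner of the lane's value-level one-vertex inequality C2 (memo g29 (2.2)/(2.3): there it is the two-level inequality Q_τ
restricted to independent supports).  The diagonal case `τ+1 ↦ τ` is `…SahiCTCSmallWorldNA.coeff_smallWorld_nonneg_of_determined`.
PROOF: the LYM/mirror argument of that file with the band indicator replaced by the WEIGHT `ψ = [P_{τ,τ+1}] + [P_{τ+1,τ}]` of the two
asymmetric bands, which is symmetric under `x ↦ #s − x` and unimodal about the middle (`band_reflect_sum_le_weighted`); the four coefficient
counts are rewritten through the bijections `card_Rset_eq`, `card_Lset_eq` of that file.  Nothing is asserted about the crux.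
-/

namespace Summit.CriticalPhenomena.PercolationContinuityZ3.Theorems.SahiCTCForms

open Finset MvPolynomial SahiCTCGenFun SahiCTCWeightedLYM

variable {α : Type*} [DecidableEq α] [Fintype α]

omit [DecidableEq α] [Fintype α] in
/-- **Weighted band reflection inequality.**  For level sequences `wI` on `0..n_I`, `wJ` on `0..n_J` with the LYM symmetry
(`wI a ≤ wI (n_I − a)` for `2a ≤ n_I`, likewise `wJ`) and a weight `ψ` on `0..n_I+n_J` that is symmetric under `x ↦ n_I + n_J − x`
and nondecreasing towards the middle (`ψ x ≤ ψ y` for `x ≤ y`, `x + y ≤ n_I + n_J`):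
`Σ_{a,b} wI_a wJ_b ψ(a+b) ≤ Σ_{a,b} wI_a wJ_b ψ(a + n_J − b)`. [this work] -/
theorem band_reflect_sum_le_weighted (nI nJ : ℕ) (wI wJ ψ : ℕ → ℤ)
    (hI : ∀ a, a ≤ nI → 2 * a ≤ nI → wI a ≤ wI (nI - a)) (hJ : ∀ b, b ≤ nJ → 2 * b ≤ nJ → wJ b ≤ wJ (nJ - b))
    (hψsymm : ∀ x, x ≤ nI + nJ → ψ x = ψ (nI + nJ - x))
    (hψmono : ∀ x y, x ≤ y → x + y ≤ nI + nJ → ψ x ≤ ψ y) :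
    ∑ a ∈ range (nI + 1), ∑ b ∈ range (nJ + 1), wI a * wJ b * ψ (a + b)
      ≤ ∑ a ∈ range (nI + 1), ∑ b ∈ range (nJ + 1), wI a * wJ b * ψ (a + (nJ - b)) := by
  set φ : ℕ → ℤ := fun x => ∑ a ∈ range (nI + 1), wI a * ψ (a + x) with hφ
  -- the inner window comparison: φ (nJ - b) ≤ φ b for 2b ≤ nJ
  have hwin : ∀ b, b ≤ nJ → 2 * b ≤ nJ → φ (nJ - b) ≤ φ b := by
    intro b hb h2b
    have hdiff : φ b - φ (nJ - b) = ∑ a ∈ range (nI + 1), (ψ (a + b) - ψ (a + (nJ - b))) * wI a := by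
      simp only [hφ, ← sum_sub_distrib]
      exact sum_congr rfl fun a _ => by ring
    rw [← sub_nonneg, hdiff]
    refine sum_antisymm_mul_nonneg nI _ _ (fun a ha => ?_) (fun a ha h2a => ?_)
    · have e1 : ψ (nI - a + b) = ψ (a + (nJ - b)) := by
        rw [hψsymm (nI - a + b) (by omega), show nI + nJ - (nI - a + b) = a + (nJ - b) by omega]
      have e2 : ψ (nI - a + (nJ - b)) = ψ (a + b) := by
        rw [hψsymm (nI - a + (nJ - b)) (by omega), show nI + nJ - (nI - a + (nJ - b)) = a + b by omega]
      rw [e1, e2]; ring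
    · have hδ : ψ (a + b) - ψ (a + (nJ - b)) ≤ 0 :=
        sub_nonpos.2 (hψmono (a + b) (a + (nJ - b)) (by omega) (by omega))
      have hw : wI a - wI (nI - a) ≤ 0 := sub_nonpos.2 (hI a ha h2a)
      have h := mul_nonneg (neg_nonneg.2 hδ) (neg_nonneg.2 hw)
      rwa [neg_mul_neg] at h
  -- rewrite both sides as Σ_b (...)·φ
  have hL : ∑ a ∈ range (nI + 1), ∑ b ∈ range (nJ + 1), wI a * wJ b * ψ (a + b)
      = ∑ b ∈ range (nJ + 1), wJ b * φ b := by
    rw [sum_comm]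
    refine sum_congr rfl fun b _ => ?_
    rw [hφ, mul_sum]
    exact sum_congr rfl fun a _ => by ring
  have hR : ∑ a ∈ range (nI + 1), ∑ b ∈ range (nJ + 1), wI a * wJ b * ψ (a + (nJ - b))
      = ∑ b ∈ range (nJ + 1), wJ (nJ - b) * φ b := by
    rw [sum_comm]
    have h1 : ∑ b ∈ range (nJ + 1), ∑ a ∈ range (nI + 1), wI a * wJ b * ψ (a + (nJ - b))
        = ∑ b ∈ range (nJ + 1), wJ b * φ (nJ - b) := by
      refine sum_congr rfl fun b _ => ?_
      rw [hφ, mul_sum]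
      exact sum_congr rfl fun a _ => by ring
    rw [h1]
    have h2 := Finset.sum_range_reflect (fun b => wJ (nJ - b) * φ b) (nJ + 1)
    simp only [Nat.add_sub_cancel] at h2
    rw [← h2]
    refine sum_congr rfl fun b hb => ?_
    rw [mem_range] at hb
    rw [show nJ - (nJ - b) = b by omega]
  rw [hL, hR, ← sub_nonneg, ← sum_sub_distrib]
  have h3 : ∑ b ∈ range (nJ + 1), (wJ (nJ - b) * φ b - wJ b * φ b) = ∑ b ∈ range (nJ + 1), (wJ (nJ - b) - wJ b) * φ b :=
    sum_congr rfl fun b _ => by ring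
  rw [h3]
  refine sum_antisymm_mul_nonneg nJ _ _ (fun b hb => ?_) (fun b hb h2b => ?_)
  · rw [show nJ - (nJ - b) = b by omega]; ring
  · exact mul_nonneg (sub_nonneg.2 (hJ b hb h2b)) (sub_nonneg.2 (hwin b hb h2b))

/-- **CROSS-NA OF TWO CONSECUTIVE SMALL WORLDS FOR INDEPENDENT SUPPORTS** (memo g41 §4.4): for up-sets `𝒳, 𝒵` with `S ∈ 𝒳 ↔ S ∩ I ∈ 𝒳` and
`S ∈ 𝒵 ↔ S \ I ∈ 𝒵` and every `τ`, every coefficient of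
`GF(𝒳_{<τ})GF(𝒵_{<τ+1}) + GF(𝒳_{<τ+1})GF(𝒵_{<τ}) − GF(2^α_{<τ})GF((𝒳∩𝒵)_{<τ+1}) − GF(2^α_{<τ+1})GF((𝒳∩𝒵)_{<τ})` is `≥ 0`. [this work] -/
theorem coeff_crossSmallWorld_nonneg_of_determined {𝒳 𝒵 : Finset (Finset α)} (h𝒳 : IsUpperSet (𝒳 : Set (Finset α)))
    (h𝒵 : IsUpperSet (𝒵 : Set (Finset α))) {I : Finset α} (hX : ∀ S : Finset α, S ∈ 𝒳 ↔ S ∩ I ∈ 𝒳)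
    (hZ : ∀ S : Finset α, S ∈ 𝒵 ↔ S \ I ∈ 𝒵) (τ : ℕ) (n : α →₀ ℕ) :
    0 ≤ (gf (𝒳.filter fun S => #S < τ) * gf (𝒵.filter fun S => #S < τ + 1)
        + gf (𝒳.filter fun S => #S < τ + 1) * gf (𝒵.filter fun S => #S < τ)
        - (gf (univ.powerset.filter fun S : Finset α => #S < τ) * gf ((𝒳 ∩ 𝒵).filter fun S => #S < τ + 1)
          + gf (univ.powerset.filter fun S : Finset α => #S < τ + 1) * gf ((𝒳 ∩ 𝒵).filter fun S => #S < τ))).coeff n := by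
  rw [coeff_sub, sub_nonneg, coeff_add, coeff_add]
  by_cases hn : ∀ i, n i ≤ 2
  swap
  · rw [coeff_gf_mul_gf, coeff_gf_mul_gf, coeff_gf_mul_gf, coeff_gf_mul_gf, filter_prod_eq_empty _ _ n hn,
      filter_prod_eq_empty _ _ n hn, filter_prod_eq_empty _ _ n hn, filter_prod_eq_empty _ _ n hn]
  rw [coeff_gf_mul_gf_eq_card_tr _ _ hn, coeff_gf_mul_gf_eq_card_tr _ _ hn, coeff_gf_mul_gf_eq_card_tr _ _ hn,
    coeff_gf_mul_gf_eq_card_tr _ _ hn]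
  set D := dbl n with hD
  set s := sgl n with hs
  have hDs : Disjoint D s := disjoint_dbl_sgl n
  -- the two asymmetric band predicates `Pt t₁ t₂ x := #D + x < t₁ ∧ #D + #s < t₂ + x`
  set P1 : ℕ → Prop := fun x => #D + x < τ ∧ #D + #s < (τ + 1) + x with hP1def
  set P2 : ℕ → Prop := fun x => #D + x < τ + 1 ∧ #D + #s < τ + x with hP2def
  have hcardDU : ∀ U, U ⊆ s → #(D ∪ U) = #D + #U := fun U hU => card_union_of_disjoint (hDs.mono_right hU)
  have hcompl : ∀ U, U ⊆ s → #(D ∪ (s \ U)) = #D + #s - #U := fun U hU => by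
    rw [hcardDU _ sdiff_subset, card_sdiff_of_subset hU]; have := card_le_card hU; omega
  -- R-side counts (the Θ·Y products): U ↦ s \ U
  have hRgen : ∀ (t₁ t₂ : ℕ) (P : ℕ → Prop) [DecidablePred P],
      (∀ y, y ≤ #s → (P y ↔ (#D + y < t₂ ∧ #D + #s < t₁ + y))) →
      #((tr (univ.powerset.filter fun S : Finset α => #S < t₁) D s).filter
          fun U => s \ U ∈ tr ((𝒳 ∩ 𝒵).filter fun S => #S < t₂) D s)
        = #(s.powerset.filter fun W => (D ∪ W ∈ 𝒳 ∧ D ∪ W ∈ 𝒵) ∧ P #W) := by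
    intro t₁ t₂ P _ hP
    refine card_bij (fun U _ => s \ U) (fun U hU => ?_) (fun U hU U' hU' h => ?_) (fun W hW => ?_)
    · rw [mem_filter, mem_tr, mem_tr, mem_filter, mem_filter, mem_inter] at hU
      obtain ⟨⟨hUs, _, hU1⟩, _, ⟨hWX, hWZ⟩, hU2⟩ := hU
      refine mem_filter.2 ⟨mem_powerset.2 sdiff_subset, ⟨hWX, hWZ⟩, ?_⟩
      have hle : #(s \ U) ≤ #s := card_le_card sdiff_subset
      rw [hP _ hle]
      rw [hcardDU U hUs] at hU1; rw [hcompl U hUs] at hU2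
      rw [card_sdiff_of_subset hUs]; have := card_le_card hUs; omega
    · have h1 : U ⊆ s := (mem_tr.1 (mem_filter.1 hU).1).1
      have h2 : U' ⊆ s := (mem_tr.1 (mem_filter.1 hU').1).1
      rw [← Finset.sdiff_sdiff_eq_self h1, h, Finset.sdiff_sdiff_eq_self h2]
    · rw [mem_filter, mem_powerset] at hW
      obtain ⟨hWs, ⟨hWX, hWZ⟩, hPW⟩ := hW
      rw [hP _ (card_le_card hWs)] at hPW
      have hW' : s \ (s \ W) = W := Finset.sdiff_sdiff_eq_self hWs
      refine ⟨s \ W, mem_filter.2 ⟨mem_tr.2 ⟨sdiff_subset, mem_filter.2 ⟨mem_powerset.2 (subset_univ _), ?_⟩⟩,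
        mem_tr.2 ⟨sdiff_subset, mem_filter.2 ⟨mem_inter.2 ⟨?_, ?_⟩, ?_⟩⟩⟩, hW'⟩
      · rw [hcompl W hWs]; have := card_le_card hWs; omega
      · rw [hW']; exact hWX
      · rw [hW']; exact hWZ
      · rw [hW', hcardDU W hWs]; omega
  -- L-side counts (the X·Z products)
  have hLgen : ∀ (t₁ t₂ : ℕ) (P : ℕ → Prop) [DecidablePred P],
      (∀ y, y ≤ #s → (P y ↔ (#D + y < t₁ ∧ #D + #s < t₂ + y))) →
      #((tr (𝒳.filter fun S => #S < t₁) D s).filter fun U => s \ U ∈ tr (𝒵.filter fun S => #S < t₂) D s)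
        = #(s.powerset.filter fun U => (D ∪ U ∈ 𝒳 ∧ D ∪ (s \ U) ∈ 𝒵) ∧ P #U) := by
    intro t₁ t₂ P _ hP
    congr 1; ext U
    simp only [mem_filter, mem_tr, mem_powerset]
    constructor
    · rintro ⟨⟨hUs, hUX, hU1⟩, _, hUZ, hU2⟩
      rw [hcardDU U hUs] at hU1; rw [hcompl U hUs] at hU2
      have := card_le_card hUs
      exact ⟨hUs, ⟨hUX, hUZ⟩, (hP _ this).2 ⟨hU1, by omega⟩⟩
    · rintro ⟨hUs, ⟨hUX, hUZ⟩, hPU⟩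
      have := card_le_card hUs
      obtain ⟨hU1, hU2⟩ := (hP _ this).1 hPU
      refine ⟨⟨hUs, hUX, by rw [hcardDU U hUs]; exact hU1⟩, sdiff_subset, hUZ, by rw [hcompl U hUs]; omega⟩
  rw [hLgen τ (τ + 1) P1 (fun y _ => Iff.rfl), hLgen (τ + 1) τ P2 (fun y _ => Iff.rfl),
    hRgen τ (τ + 1) P2 (fun y _ => Iff.rfl), hRgen (τ + 1) τ P1 (fun y _ => Iff.rfl),
    card_Rset_eq hX hZ P2, card_Rset_eq hX hZ P1, card_Lset_eq hX hZ P1, card_Lset_eq hX hZ P2]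
  -- level counts and the weighted band inequality
  set 𝒜 := (s ∩ I).powerset.filter fun A => D ∪ A ∈ 𝒳 with h𝒜
  set ℬ := (s \ I).powerset.filter fun B => D ∪ B ∈ 𝒵 with hℬ
  have h𝒜card : ∀ A ∈ 𝒜, #A ≤ #(s ∩ I) := fun A hA => card_le_card (mem_powerset.1 (mem_filter.1 hA).1)
  have hℬcard : ∀ B ∈ ℬ, #B ≤ #(s \ I) := fun B hB => card_le_card (mem_powerset.1 (mem_filter.1 hB).1)
  have hsI : #(s ∩ I) + #(s \ I) = #s := by
    rw [← card_union_of_disjoint (disjoint_sdiff_inter s I).symm, union_comm, sdiff_union_inter]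
  have eL1 := card_filter_prod_eq_sum 𝒜 ℬ h𝒜card hℬcard (fun a b => P1 (a + (#(s \ I) - b)))
  have eL2 := card_filter_prod_eq_sum 𝒜 ℬ h𝒜card hℬcard (fun a b => P2 (a + (#(s \ I) - b)))
  have eR1 := card_filter_prod_eq_sum 𝒜 ℬ h𝒜card hℬcard (fun a b => P2 (a + b))
  have eR2 := card_filter_prod_eq_sum 𝒜 ℬ h𝒜card hℬcard (fun a b => P1 (a + b))
  set ψ : ℕ → ℤ := fun x => (if P1 x then 1 else 0) + (if P2 x then 1 else 0) with hψdef
  have key := band_reflect_sum_le_weighted (#(s ∩ I)) (#(s \ I)) (fun a => (#(𝒜.filter fun A => #A = a) : ℤ))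
    (fun b => (#(ℬ.filter fun B => #B = b) : ℤ)) ψ (fun a ha h2a => ?_) (fun b hb h2b => ?_) (fun x hx => ?_)
    (fun x y hxy hxyN => ?_)
  · -- assemble: (R2 + R1 as sums) ≤ (L1 + L2 as sums)
    have hsumL : ∑ a ∈ range (#(s ∩ I) + 1), ∑ b ∈ range (#(s \ I) + 1),
        (#(𝒜.filter fun A => #A = a) : ℤ) * #(ℬ.filter fun B => #B = b) * ψ (a + (#(s \ I) - b))
        = ∑ a ∈ range (#(s ∩ I) + 1), ∑ b ∈ range (#(s \ I) + 1),
            (#(𝒜.filter fun A => #A = a) : ℤ) * #(ℬ.filter fun B => #B = b) * (if P1 (a + (#(s \ I) - b)) then 1 else 0)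
          + ∑ a ∈ range (#(s ∩ I) + 1), ∑ b ∈ range (#(s \ I) + 1),
            (#(𝒜.filter fun A => #A = a) : ℤ) * #(ℬ.filter fun B => #B = b) * (if P2 (a + (#(s \ I) - b)) then 1 else 0) := by
      rw [← sum_add_distrib]
      refine sum_congr rfl fun a _ => ?_
      rw [← sum_add_distrib]
      exact sum_congr rfl fun b _ => by simp only [hψdef]; ring
    have hsumR : ∑ a ∈ range (#(s ∩ I) + 1), ∑ b ∈ range (#(s \ I) + 1),
        (#(𝒜.filter fun A => #A = a) : ℤ) * #(ℬ.filter fun B => #B = b) * ψ (a + b)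
        = ∑ a ∈ range (#(s ∩ I) + 1), ∑ b ∈ range (#(s \ I) + 1),
            (#(𝒜.filter fun A => #A = a) : ℤ) * #(ℬ.filter fun B => #B = b) * (if P1 (a + b) then 1 else 0)
          + ∑ a ∈ range (#(s ∩ I) + 1), ∑ b ∈ range (#(s \ I) + 1),
            (#(𝒜.filter fun A => #A = a) : ℤ) * #(ℬ.filter fun B => #B = b) * (if P2 (a + b) then 1 else 0) := by
      rw [← sum_add_distrib]
      refine sum_congr rfl fun a _ => ?_
      rw [← sum_add_distrib]
      exact sum_congr rfl fun b _ => by simp only [hψdef]; ring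
    rw [hsumL, hsumR, ← eL1, ← eL2, ← eR1, ← eR2] at key
    linarith [key]
  · exact_mod_cast card_trace_level_le 𝒳 h𝒳 (hDs.mono_right inter_subset_left) ha h2a
  · exact_mod_cast card_trace_level_le 𝒵 h𝒵 (hDs.mono_right sdiff_subset) hb h2b
  · -- symmetry of ψ under x ↦ #s − x
    rw [hsI] at hx
    have e1 : P1 x ↔ P2 (#(s ∩ I) + #(s \ I) - x) := by
      simp only [hP1def, hP2def]; rw [hsI]; omega
    have e2 : P2 x ↔ P1 (#(s ∩ I) + #(s \ I) - x) := by
      simp only [hP1def, hP2def]; rw [hsI]; omega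
    simp only [hψdef, e1, e2]; ring
  · -- unimodality of ψ towards the middle
    rw [hsI] at hxyN
    simp only [hψdef, hP1def, hP2def]
    split_ifs <;> omega

end Summit.CriticalPhenomena.PercolationContinuityZ3.Theorems.SahiCTCForms
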